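import Summits.ResolutionOfSingularities.ResolutionOfSingularities.Theorems.HilbertSamuelEliminationCampaignW42DirectrixDropLocal
import HarnessLib

/-!
# [OURS · L1 W4.2] CJS Thm. 3.10 (4) UNCONDITIONALLY, FOR EVERY COEFFICIENT FIELD: at a near point of a permissible blow-up
# `e_{x'}(X')_K + tr.deg(κ(x')/κ(x)) ≤ e_x(X)_K` for EVERY field `K ⊇ κ(x')` (imperfect allowed, every characteristic) —
# the named fact `CossartJannsenSaito2020_thm_3_10_4` DISCHARGED (campaign s42, cell res-hironaka; informal crux `RidgeConfinement`,
# stmt-ResolutionOfSingularities-17845; `--supports`)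

HONEST FRAMING. OURS (slot W4.2, prover res-L1-s42-pv-1, gen 6). The tree's named fact `CossartJannsenSaito2020_thm_3_10_4`
(`Literature/AlgebraicGeometry/Resolution/PermissibleBlowupDirectrix.lean`; V. Cossart, U. Jannsen, S. Saito, LNM 2270 (2020)
Thm. 3.10 (4), there deduced from H. Hironaka's *Characters `ν*` and `τ*`* (1967) Thm. (1,A)) was, before this file, a theorem of
the tree only for PERFECT `K` (gen 5, `thm_3_10_4_of_perfectField`: `e_K = dim F` and Dietel (8.2.7) (ii)). This file proves it
for EVERY field `K` from the local-ring form `exists_dirDimOver_add_le_of_isNearRing` (`…CampaignW42DirectrixDropLocal`) exactly as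
gen 5's `ridgeDimDropAt_of_isNearPoint` was obtained from its local form (Rees chart at `x'`, alignment `d = tr.deg`,
Hironaka–Grothendieck `e_x(X)_K = e(I(c) · K[Y]) + s`):

* `dirDimOver_add_trdeg_le_of_isNearPoint` — SCHEMES: `X` locally noetherian with `𝒪_{X,x}` universally catenary, `D` permissible
  at `x = π x'`, `π` a blow-up in `D`, `x'` near at any level `N`, `K` over `κ(x')` and `κ(x)` compatibly:
  `e_{x'}(X')_K + tr.deg(κ(x')/κ(x)) ≤ e_x(X)_K`; `…_of_isExcellent` — on an excellent scheme with permissible `D`;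
* **`Literature.AlgebraicGeometry.Resolution.CossartJannsenSaito2020_thm_3_10_4_holds : CossartJannsenSaito2020_thm_3_10_4`** —
  the named fact's statement verbatim, PROVED (declared with its absolute name next to the fact; summit-side alias
  `CampaignW42.cossartJannsenSaito2020_thm_3_10_4_holds`).

NOTHING here is a statement of H. Hironaka's manuscript [Hironaka2017]; nothing about resolution of singularities in positive
characteristic is asserted beyond this monotonicity of the directrix. AI review is weaker than expert review. References
(orientation only): V. Cossart, U. Jannsen, S. Saito, LNM 2270 (2020), Thm. 3.10 (4), proof p. 46–50; H. Hironaka, J. Math.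
Kyoto Univ. 7 (1967), Thm. (1,A); B. Dietel, Dissertation Regensburg (2015), Satz (8.2.7) p. 105.
-/

noncomputable section

-- single-conjunct summit: the doubled namespace component `ResolutionOfSingularities` is mandated
set_option linter.dupNamespace false
-- localizations of polynomial rings over quotient rings: nested instance problems (as in the gen-3/4/5 files)
set_option maxSynthPendingDepth 3

open CategoryTheory AlgebraicGeometry TopologicalSpace IsLocalRing MvPolynomial Module
open Literature.AlgebraicGeometry.Resolution Literature.AlgebraicGeometry.Resolution.HironakaScheme
open Literature.RingTheory.HilbertSamuel Literature.RingTheory.MvPolynomial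
open Literature.AlgebraicGeometry.CossartJannsenSaito2020
open Summit.ResolutionOfSingularities.ResolutionOfSingularities.Theorems.SigmaMaxModificationsCorridor3.Directrix214Sharp

namespace Summit.ResolutionOfSingularities.ResolutionOfSingularities.Theorems

namespace CampaignW42

universe u

/-! ## Schemes -/

section Schemes

variable {X X' : Scheme.{u}} [IsLocallyNoetherian X] [IsLocallyNoetherian X'] {π : X' ⟶ X} {D : X.IdealSheafData}

/-- **`e_{x'}(X')_K + tr.deg(κ(x')/κ(x)) ≤ e_x(X)_K` at a near point of a permissible blow-up, for EVERY field `K` over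
`κ(x')` and `κ(x)` compatibly — UNCONDITIONAL** (CJS Thm. 3.10 (4); every characteristic, imperfect `K` allowed, any level `N`).
`X` locally noetherian with `𝒪_{X,x}` universally catenary, `D` permissible at `x = π(x')`, `π` a blow-up in `D`,
`H^N_{X'}(x') = H^N_X(x)`. [cite: CossartJannsenSaito2020, Thm. 3.10 (4), proof p. 46–50] [cite: Dietel2015, Satz (8.2.7) (ii) p. 105] -/
theorem dirDimOver_add_trdeg_le_of_isNearPoint (hπ : IsBlowup π D) (x' : X')
    (hperm : IdealSheafData.IsPermissibleAt D (π.base x')) (hUC : IsUniversallyCatenaryRing (X.presheaf.stalk (π.base x')))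
    {N : ℕ} (hnear : IsNearPoint π N x') (K : Type u) [Field K]
    [Algebra (ResidueField (X'.presheaf.stalk x')) K] [Algebra (ResidueField (X.presheaf.stalk (π.base x'))) K]
    (halg : ∀ a, algebraMap (ResidueField (X.presheaf.stalk (π.base x'))) K a =
      algebraMap (ResidueField (X'.presheaf.stalk x')) K ((π.residueFieldMap x').hom a)) :
    (Scheme.dirDimOver X' x' K : Cardinal.{u}) +
        @Algebra.trdeg (X.residueField (π.base x')) (X'.residueField x') _ _ (residueAlgebra π x') ≤
      (Scheme.dirDimOver X (π.base x') K : Cardinal.{u}) := by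
  classical
  have hIperm : (stalkIdeal D (π.base x')).IsPermissible := hperm
  -- minimal generators `(g, y)` of `𝔫 = 𝔪_{X,x}` adapted to `D`, and `e_x(X)_K = e(I(g) · K[Y]) + s`
  obtain ⟨n, s, g, y, hz, hgI, hn, hdimI, hE, hJz⟩ :=
    exists_minimal_generators_data HerrmannIkedaOrbanz1988_cor_21_11_holds hIperm
  have hR : Scheme.dirDimOver X (π.base x') K =
      directrixDim ((normalConeIdeal g).map (MvPolynomial.map (algebraMap (ResidueField (X.presheaf.stalk (π.base x'))) K))) + s := by
    change dirDimOver (X.presheaf.stalk (π.base x')) K = _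
    rw [dirDimOver_eq' (X.presheaf.stalk (π.base x')) K hE (Fin.append g y) hz, hJz, map_map_rename_eq,
      directrixDim_map_rename_castAdd]
  -- no linear forms in `I(g)` (the generators are minimal)
  have hI1 : finrank (ResidueField (X.presheaf.stalk (π.base x'))) (idealDegree (fibreConeIdeal g) 1) = 0 := by
    rw [fibreConeIdeal_eq_normalConeIdeal]
    refine finrank_idealDegree_one_eq_zero_of_map_rename s (normalConeIdeal g) ?_
    rw [← hJz]
    exact finrank_idealDegree_tangentConeIdeal_one_eq_zero hE (Fin.append g y) hz
  -- the Rees chart presenting `𝒪_{X',x'}`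
  obtain ⟨j, 𝔴, χ, hχ, hloc, h𝔴⟩ := hπ.exists_reesChart_stalk x' g hgI
  letI algCO : Algebra (chartRing g j) (X'.presheaf.stalk x') := χ.toAlgebra
  letI algRO : Algebra (X.presheaf.stalk (π.base x')) (X'.presheaf.stalk x') := (π.stalkMap x').hom.toAlgebra
  haveI : IsLocalization.AtPrime (X'.presheaf.stalk x') 𝔴.asIdeal := hloc
  have hp : (Ideal.span (Set.range g)).IsPermissible := by rw [hgI]; exact hIperm
  haveI : IsRegularLocalRing (X.presheaf.stalk (π.base x') ⧸ Ideal.span (Set.range g)) := hp.1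
  haveI : IsDomain (X.presheaf.stalk (π.base x') ⧸ Ideal.span (Set.range g)) := isDomain_of_isRegularLocalRing _
  haveI : (Ideal.span (Set.range g)).IsPrime := (Ideal.Quotient.isDomain_iff_prime _).mp inferInstance
  have hs : ringKrullDim (X.presheaf.stalk (π.base x') ⧸ Ideal.span (Set.range g)) = s := by rw [hgI]; exact hdimI
  have hOO' : ∀ r : X.presheaf.stalk (π.base x'),
      algebraMap (X.presheaf.stalk (π.base x')) (X'.presheaf.stalk x') r =
        (algebraMap (chartRing g j) (X'.presheaf.stalk x') : chartRing g j →+* X'.presheaf.stalk x') (chartBase g j r) :=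
    fun r => (hχ r).symm
  have hnear' : IsNearRing (X.presheaf.stalk (π.base x')) (X'.presheaf.stalk x') N := by
    unfold IsNearRing
    have h := hnear
    rw [IsNearPoint, Scheme.hsFun_def, Scheme.hsFun_def] at h
    exact h
  have hK : ∀ r : X.presheaf.stalk (π.base x'),
      algebraMap (ResidueField (X'.presheaf.stalk x')) K (residue (X'.presheaf.stalk x')
        (algebraMap (X.presheaf.stalk (π.base x')) (X'.presheaf.stalk x') r)) =
      algebraMap (ResidueField (X.presheaf.stalk (π.base x'))) K (residue (X.presheaf.stalk (π.base x')) r) := fun r => by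
    rw [halg]
    congr 1
  obtain ⟨d, hHd, hRd⟩ := exists_dirDimOver_add_le_of_isNearRing g j 𝔴.asIdeal (X'.presheaf.stalk x') hUC hs hp.2.1 h𝔴
    hOO' hnear' hI1 K hK
  -- `d = tr.deg(κ(x')/κ(x))` by the alignment
  obtain ⟨d', htr, -, hH'⟩ := exists_trdeg_hilbertSamuelFun_eq_of_hsFun_eq hπ x' hperm hUC N hnear
  have hdd : d' = d := by
    have h := hilbertSamuelFun_index_injective (hH'.trans hHd.symm)
    omega
  have htr' : @Algebra.trdeg (X.residueField (π.base x')) (X'.residueField x') _ _ (residueAlgebra π x') = (d : Cardinal.{u}) := by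
    rw [← hdd]; exact htr
  rw [htr', hR]
  have hfin : Scheme.dirDimOver X' x' K + d ≤
      directrixDim ((normalConeIdeal g).map (MvPolynomial.map (algebraMap (ResidueField (X.presheaf.stalk (π.base x'))) K))) + s := by
    rw [← fibreConeIdeal_eq_normalConeIdeal]; exact hRd
  exact_mod_cast hfin

/-- **The same on an EXCELLENT scheme with a permissible `D`** (the hypotheses of the named fact, minus `N ≥ dim X`).
[cite: CossartJannsenSaito2020, Thm. 3.10 (4)] -/
theorem dirDimOver_add_trdeg_le_of_isNearPoint_of_isExcellent (hX : Scheme.IsExcellent X) (hD : IdealSheafData.IsPermissible D)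
    (hπ : IsBlowup π D) {N : ℕ} (x' : X') (hx : π.base x' ∈ (D.support : Set X)) (hnear : IsNearPoint π N x')
    (K : Type u) [Field K] [Algebra (ResidueField (X'.presheaf.stalk x')) K] [Algebra (ResidueField (X.presheaf.stalk (π.base x'))) K]
    (halg : ∀ a, algebraMap (ResidueField (X.presheaf.stalk (π.base x'))) K a =
      algebraMap (ResidueField (X'.presheaf.stalk x')) K ((π.residueFieldMap x').hom a)) :
    (Scheme.dirDimOver X' x' K : Cardinal.{u}) +
        @Algebra.trdeg (X.residueField (π.base x')) (X'.residueField x') _ _ (residueAlgebra π x') ≤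
      (Scheme.dirDimOver X (π.base x') K : Cardinal.{u}) :=
  dirDimOver_add_trdeg_le_of_isNearPoint hπ x' (hD _ hx) (hX.isUniversallyCatenaryRing_stalk _) hnear K halg

/-- **CJS Thm. 3.10 (4) (Cossart–Jannsen–Saito 2020 / Hironaka 1967 Thm. (1,A)) — the tree's named fact
`CossartJannsenSaito2020_thm_3_10_4`, PROVED: at a near point of a permissible blow-up of an excellent scheme, for every field
`K ⊇ κ(x')`, `e_{x'}(X')_K + tr.deg_{κ(x)} κ(x') ≤ e_x(X)_K`.** Declared with its absolute name next to the fact (same namespace),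
from this summit-side file because the proof imports the campaign's cone / ridge / directrix chain
(`Summits/…/Theorems/HilbertSamuelEliminationCampaignW42*`); OURS, NOT a statement of H. Hironaka's manuscript [Hironaka2017].
[cite: CossartJannsenSaito2020, Thm. 3.10 (4)] [cite: Hironaka1967Characters, Theorem (1,A)] -/
theorem _root_.Literature.AlgebraicGeometry.Resolution.CossartJannsenSaito2020_thm_3_10_4_holds :
    CossartJannsenSaito2020_thm_3_10_4.{u} := by
  intro X X' _ _ π D hX hD hπ N _ x' hx hnear K _ _ _ halg
  exact dirDimOver_add_trdeg_le_of_isNearPoint_of_isExcellent hX hD hπ x' hx hnear K halg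

/-- Summit-side alias of `Literature.AlgebraicGeometry.Resolution.CossartJannsenSaito2020_thm_3_10_4_holds` in the campaign
namespace. OURS; NOT a statement of the manuscript. [cite: CossartJannsenSaito2020, Thm. 3.10 (4)] -/
theorem cossartJannsenSaito2020_thm_3_10_4_holds : CossartJannsenSaito2020_thm_3_10_4.{u} :=
  Literature.AlgebraicGeometry.Resolution.CossartJannsenSaito2020_thm_3_10_4_holds

end Schemes

end CampaignW42

end Summit.ResolutionOfSingularities.ResolutionOfSingularities.Theorems

end
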